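import Summits.Ventures.PercRepro.LemmaBPointed

/-!
# Lemma B for block maps (coloured families of disjoint blocks of coordinates)

A **block map** is determined by pairwise disjoint nonempty blocks `B l` (`l : Fin t`) of
coordinates, each with a colour `col l : Fin 3`: the cell of a configuration `ω` is the join of the
crossing partitions `cross4 (col l)` over the blocks `B l ≤ ω` fully contained in `ω`
(`blockMap B col`). So `c ω = ⊥` iff `ω` contains no block, `c ω = cross4 i` iff it contains blocks
of the colour `i` only, and `c ω = ⊤` iff it contains blocks of two colours. Coordinates outside the
blocks are inert. The axis family of `proofs/P4-gen9.md` §12.8 is the case of three blocks of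
distinct colours; the families with four or five axes (colours repeated) are block maps as well.

Lemma B holds for every block map: a bad configuration `ω` (`c ω = x_i`, `c ωᶜ = x_j`, `i < j`)
contains `i`-blocks only, its complement `j`-blocks only, and every other block is split; its
**partial part** `P = ω ∖ ⨆{B l | B l ≤ ω}` contains no block (so `c P = ⊥`) while `Pᶜ` contains an
`i`-block and a `j`-block (so `c Pᶜ = ⊤`). The map `ω ↦ Pᶜ` is injective on the bad set: the blocks
disjoint from `P` are exactly the blocks full in `ω` or in `ωᶜ`, their colours are `{i, j}`, and `ω`
is `P` together with the `i`-coloured ones. Hence `crossCount ≤ topBotCount`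
(`crossCount_le_topBotCount_blockMap`).
-/

namespace PercRepro

open Finset

variable {S : Type} [Fintype S] [DecidableEq S] {t : ℕ}

section BlockMapDef

variable (B : Fin t → Config S) (col : Fin t → Fin 3)

open Classical in
/-- The blocks fully contained in `ω`. -/
noncomputable def fullBlocks (ω : Config S) : Finset (Fin t) :=
  Finset.univ.filter fun l => B l ≤ ω

open Classical in
/-- The **block map**: the cell of `ω` is the join of the crossing partitions of the colours of the
blocks contained in `ω`. -/
noncomputable def blockMap (ω : Config S) : Setoid (Fin 4) :=
  (fullBlocks B ω).sup fun l => cross4 (col l)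

open Classical in
/-- The partial part of `ω`: `ω` minus its full blocks. -/
noncomputable def partialPart (ω : Config S) : Config S := ω \ (fullBlocks B ω).sup B

/-- A **block family**: pairwise disjoint nonempty blocks. -/
structure IsBlockFamily (B : Fin t → Config S) : Prop where
  inf_eq_bot : ∀ {l m : Fin t}, l ≠ m → B l ⊓ B m = ⊥
  ne_bot : ∀ l, B l ≠ ⊥

end BlockMapDef

section BlockMapLemmas

variable {B : Fin t → Config S} {col : Fin t → Fin 3}

omit [Fintype S] [DecidableEq S] in
/-- A block is full in `ω` iff it lies below `ω`. -/
theorem mem_fullBlocks {ω : Config S} {l : Fin t} : l ∈ fullBlocks B ω ↔ B l ≤ ω := by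
  classical
  unfold fullBlocks
  simp only [Finset.mem_filter, Finset.mem_univ, true_and]

omit [Fintype S] [DecidableEq S] in
/-- Block maps are monotone. -/
theorem monotone_blockMap : Monotone (blockMap B col) := by
  intro ω ω' h
  unfold blockMap
  refine Finset.sup_mono ?_
  intro l hl
  exact mem_fullBlocks.2 (le_trans (mem_fullBlocks.1 hl) h)

omit [Fintype S] [DecidableEq S] in
/-- The full blocks of `ω` lie below `ω`. -/
theorem sup_fullBlocks_le (ω : Config S) : (fullBlocks B ω).sup B ≤ ω :=
  Finset.sup_le fun _ hl => mem_fullBlocks.1 hl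

omit [Fintype S] [DecidableEq S] in
/-- `ω` is its full blocks together with its partial part. -/
theorem sup_fullBlocks_sup_partialPart (ω : Config S) :
    (fullBlocks B ω).sup B ⊔ partialPart B ω = ω :=
  sup_sdiff_cancel_right (sup_fullBlocks_le ω)

omit [Fintype S] [DecidableEq S] in
/-- If `ω` has cell `cross4 i`, every full block of `ω` has colour `i`. -/
theorem col_eq_of_blockMap_eq {ω : Config S} {i : Fin 3} (h : blockMap B col ω = cross4 i)
    {l : Fin t} (hl : l ∈ fullBlocks B ω) : col l = i := by
  have hle : cross4 (col l) ≤ cross4 i := by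
    rw [← h]
    exact Finset.le_sup (f := fun l => cross4 (col l)) hl
  by_contra hne
  have hinf : cross4 (col l) ⊓ cross4 i = cross4 (col l) := inf_eq_left.2 hle
  rw [cross4_inf_eq_bot hne] at hinf
  exact cross4_ne_bot (col l) hinf.symm

omit [Fintype S] [DecidableEq S] in
/-- If `ω` has cell `cross4 i`, it contains a block. -/
theorem fullBlocks_nonempty_of_blockMap_eq {ω : Config S} {i : Fin 3}
    (h : blockMap B col ω = cross4 i) : (fullBlocks B ω).Nonempty := by
  by_contra hne
  rw [Finset.not_nonempty_iff_eq_empty] at hne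
  unfold blockMap at h
  rw [hne, Finset.sup_empty] at h
  exact cross4_ne_bot i h.symm

omit [Fintype S] [DecidableEq S] in
/-- A block meets the full blocks of `ω` only if it is one of them. -/
theorem inf_sup_fullBlocks_eq_bot (hB : IsBlockFamily B) {ω : Config S} {l : Fin t}
    (hl : l ∉ fullBlocks B ω) : B l ⊓ (fullBlocks B ω).sup B = ⊥ := by
  rw [Finset.sup_inf_distrib_left]
  refine (Finset.sup_eq_bot_iff _ _).2 fun m hm => ?_
  exact hB.inf_eq_bot fun h => hl (h ▸ hm)

omit [Fintype S] [DecidableEq S] in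
/-- The partial part contains no block. -/
theorem fullBlocks_partialPart (hB : IsBlockFamily B) (ω : Config S) :
    fullBlocks B (partialPart B ω) = ∅ := by
  classical
  refine Finset.eq_empty_of_forall_notMem fun l hl => ?_
  have hlP : B l ≤ partialPart B ω := mem_fullBlocks.1 hl
  have hlω : l ∈ fullBlocks B ω := mem_fullBlocks.2 (hlP.trans sdiff_le)
  have hsup : B l ≤ (fullBlocks B ω).sup B := Finset.le_sup hlω
  apply hB.ne_bot l
  rw [← le_bot_iff, ← inf_compl_eq_bot (a := (fullBlocks B ω).sup B)]
  refine le_inf hsup ?_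
  calc B l ≤ partialPart B ω := hlP
    _ ≤ ((fullBlocks B ω).sup B)ᶜ := by
      unfold partialPart
      rw [sdiff_eq]
      exact inf_le_right

omit [Fintype S] [DecidableEq S] in
/-- The blocks disjoint from the partial part of `ω` are exactly those full in `ω` or in `ωᶜ`. -/
theorem inf_partialPart_eq_bot_iff (hB : IsBlockFamily B) {ω : Config S} {l : Fin t} :
    B l ⊓ partialPart B ω = ⊥ ↔ l ∈ fullBlocks B ω ∨ l ∈ fullBlocks B ωᶜ := by
  constructor
  · intro h
    by_contra hn
    push Not at hn
    obtain ⟨h1, h2⟩ := hn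
    -- `B l` is split: `B l ⊓ ω ≠ ⊥` and `B l ⊓ ω ≤ partialPart`.
    have hsplit : B l ⊓ ω ≠ ⊥ := by
      intro h0
      apply h2
      rw [mem_fullBlocks, le_compl_iff_disjoint_right, disjoint_iff]
      exact h0
    apply hsplit
    rw [← le_bot_iff, ← h]
    refine le_inf inf_le_left ?_
    unfold partialPart
    rw [le_sdiff]
    refine ⟨inf_le_right, ?_⟩
    rw [disjoint_iff, ← le_bot_iff]
    calc B l ⊓ ω ⊓ (fullBlocks B ω).sup B ≤ B l ⊓ (fullBlocks B ω).sup B :=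
          inf_le_inf_right _ inf_le_left
      _ = ⊥ := inf_sup_fullBlocks_eq_bot hB h1
  · rintro (h | h)
    · rw [← le_bot_iff]
      calc B l ⊓ partialPart B ω ≤ (fullBlocks B ω).sup B ⊓ partialPart B ω :=
            inf_le_inf_right _ (Finset.le_sup h)
        _ = ⊥ := by
          unfold partialPart
          rw [sdiff_eq, inf_left_comm, inf_compl_eq_bot, inf_bot_eq]
    · rw [← le_bot_iff]
      calc B l ⊓ partialPart B ω ≤ ωᶜ ⊓ ω := inf_le_inf (mem_fullBlocks.1 h) sdiff_le
        _ = ⊥ := compl_inf_eq_bot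

end BlockMapLemmas

section Main

variable {B : Fin t → Config S} {col : Fin t → Fin 3}

/-- The partial part of a bad configuration is the `⊥`-member of a good pair. -/
theorem compl_partialPart_mem_goodSet (hB : IsBlockFamily B) {ω : Config S}
    (hω : ω ∈ badSet cross4 (blockMap B col)) :
    (partialPart B ω)ᶜ ∈ goodSet (blockMap B col) := by
  classical
  obtain ⟨-, i, j, hij, hi, hj⟩ := Finset.mem_filter.1 hω
  refine Finset.mem_filter.2 ⟨Finset.mem_univ _, ?_, ?_⟩
  · -- the complement of the partial part contains an `i`-block and a `j`-block
    obtain ⟨l, hl⟩ := fullBlocks_nonempty_of_blockMap_eq hi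
    obtain ⟨m, hm⟩ := fullBlocks_nonempty_of_blockMap_eq hj
    have hcompl : (partialPart B ω)ᶜ = ωᶜ ⊔ (fullBlocks B ω).sup B := by
      unfold partialPart
      rw [sdiff_eq, compl_inf, compl_compl]
    have hl' : l ∈ fullBlocks B (partialPart B ω)ᶜ := by
      rw [mem_fullBlocks, hcompl]
      exact le_sup_of_le_right (Finset.le_sup hl)
    have hm' : m ∈ fullBlocks B (partialPart B ω)ᶜ := by
      rw [mem_fullBlocks, hcompl]
      exact le_sup_of_le_left (mem_fullBlocks.1 hm)
    refine top_unique ?_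
    rw [← cross4_sup_eq_top hij.ne, ← col_eq_of_blockMap_eq hi hl, ← col_eq_of_blockMap_eq hj hm]
    exact sup_le (Finset.le_sup (f := fun l => cross4 (col l)) hl')
      (Finset.le_sup (f := fun l => cross4 (col l)) hm')
  · rw [compl_compl]
    unfold blockMap
    rw [fullBlocks_partialPart hB, Finset.sup_empty]

/-- Two increasing pairs of colours drawn from the same two-element colour set coincide. -/
theorem eq_of_mem_pair_fin3 {i₁ j₁ i₂ j₂ : Fin 3} (h₁ : i₁ < j₁) (h₂ : i₂ < j₂)
    (hi : i₂ = i₁ ∨ i₂ = j₁) (hj : j₂ = i₁ ∨ j₂ = j₁) : i₁ = i₂ ∧ j₁ = j₂ := by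
  revert hi hj h₁ h₂; revert i₁ j₁ i₂ j₂; decide

omit [DecidableEq S] in
/-- The full blocks of a bad configuration of type `(i, j)` are the `i`-coloured blocks disjoint
from its partial part. -/
theorem fullBlocks_eq_filter (hB : IsBlockFamily B) {ω : Config S} {i j : Fin 3} (hij : i ≠ j)
    (hi : blockMap B col ω = cross4 i) (hj : blockMap B col ωᶜ = cross4 j) :
    fullBlocks B ω = Finset.univ.filter fun l => B l ⊓ partialPart B ω = ⊥ ∧ col l = i := by
  classical
  ext l
  simp only [Finset.mem_filter, Finset.mem_univ, true_and]
  constructor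
  · intro hl
    exact ⟨(inf_partialPart_eq_bot_iff hB).2 (Or.inl hl), col_eq_of_blockMap_eq hi hl⟩
  · rintro ⟨hdisj, hcol⟩
    rcases (inf_partialPart_eq_bot_iff hB).1 hdisj with h | h
    · exact h
    · exact absurd (hcol.symm.trans (col_eq_of_blockMap_eq hj h)) hij

/-- **Lemma B for block maps**: for pairwise disjoint nonempty blocks `B l` with colours `col l`,
the block map `blockMap B col` satisfies `crossCount ≤ topBotCount`. The injection sends a bad
configuration to the complement of its partial part. -/
theorem crossCount_le_topBotCount_blockMap (hB : IsBlockFamily B) (col : Fin t → Fin 3) :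
    crossCount cross4 (blockMap B col) ≤ topBotCount (blockMap B col) := by
  classical
  rw [crossCount_eq_card_badSet, topBotCount_eq_card_goodSet]
  refine Finset.card_le_card_of_injOn (fun ω => (partialPart B ω)ᶜ)
    (fun ω hω => compl_partialPart_mem_goodSet hB hω) ?_
  intro ω₁ hω₁ ω₂ hω₂ heq
  obtain ⟨-, i₁, j₁, hij₁, hi₁, hj₁⟩ := Finset.mem_filter.1 (Finset.mem_coe.1 hω₁)
  obtain ⟨-, i₂, j₂, hij₂, hi₂, hj₂⟩ := Finset.mem_filter.1 (Finset.mem_coe.1 hω₂)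
  have hP : partialPart B ω₁ = partialPart B ω₂ := compl_inj_iff.1 heq
  -- a block disjoint from the common partial part has colour `i₁` or `j₁`
  have key : ∀ {l : Fin t}, B l ⊓ partialPart B ω₁ = ⊥ → col l = i₁ ∨ col l = j₁ := by
    intro l hl
    rcases (inf_partialPart_eq_bot_iff hB).1 hl with h | h
    · exact Or.inl (col_eq_of_blockMap_eq hi₁ h)
    · exact Or.inr (col_eq_of_blockMap_eq hj₁ h)
  obtain ⟨l, hl⟩ := fullBlocks_nonempty_of_blockMap_eq hi₂
  obtain ⟨m, hm⟩ := fullBlocks_nonempty_of_blockMap_eq hj₂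
  have hli : col l = i₂ := col_eq_of_blockMap_eq hi₂ hl
  have hmj : col m = j₂ := col_eq_of_blockMap_eq hj₂ hm
  have hl' : B l ⊓ partialPart B ω₁ = ⊥ := by
    rw [hP]; exact (inf_partialPart_eq_bot_iff hB).2 (Or.inl hl)
  have hm' : B m ⊓ partialPart B ω₁ = ⊥ := by
    rw [hP]; exact (inf_partialPart_eq_bot_iff hB).2 (Or.inr hm)
  have hi : i₂ = i₁ ∨ i₂ = j₁ := by rw [← hli]; exact key hl'
  have hj : j₂ = i₁ ∨ j₂ = j₁ := by rw [← hmj]; exact key hm'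
  obtain ⟨rfl, -⟩ := eq_of_mem_pair_fin3 hij₁ hij₂ hi hj
  -- same lower colour and same partial part: same full blocks, hence the same configuration
  have hF : fullBlocks B ω₁ = fullBlocks B ω₂ := by
    rw [fullBlocks_eq_filter hB hij₁.ne hi₁ hj₁, fullBlocks_eq_filter hB hij₂.ne hi₂ hj₂, hP]
  rw [← sup_fullBlocks_sup_partialPart ω₁, ← sup_fullBlocks_sup_partialPart ω₂, hF, hP]

end Main

end PercRepro
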